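import Summits.QuantumFields.YangMills.Theorems.IR.VacuumEscapeSpectralSeam
import Literature.MathematicalPhysics.QuantumFieldTheory.Balaban1983to89.MassGapFunctionalInequalities
import HarnessLib

/-!
# Line `vacuum_escape` (crux `BalabanLadder.IR`, stmt-QuantumFields-19354) — corollaries of the spectral seam:
# JW's transfer gap with thermal control at HALF HEIGHT suffices for the lattice mass-gap clause

The spectral seam `abs_latticeConnectedCorr_le_of_gap_purity` (`Theorems/IR/VacuumEscapeSpectralSeam.lean`) consumes, on the spatial
torus `(2S+1)³`, only (i) a RATE for the trace excesses `x(t) ≤ K e^{−μ t}` (`K` free in `(β, S)`) and (ii) ONE multiplicity bound at the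
half height of the symmetric torus, `x(S+1) ≤ K₀`.  This file records what that means for the typed transfer-gap currencies of
`Literature/…/Balaban1983to89/MassGapFunctionalInequalities.lean` (namespace `…Sufficient`):

* `gap_purity_of_transferGapThermal` — §5's FI-T `TransferGapThermal ρ β S μ X` (`x(t+1) ≤ X e^{−μ(t−S)}` for `t ≥ S`) supplies
  both inputs (`K := X e^{μ(S+1)} + Σ_{m<S} |x(m+2)| e^{μ(m+2)}`, `K₀ := X`);
* `abs_latticeConnectedCorr_le_of_transferGapThermal` — FI-T on ONE torus ⇒ clustering of all gauge-invariant local observables at the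
  same rate, constant `C_A C_B e^{2w}(2 + 5X + X²)`, for ALL separations `n ≤ S`;
* `uniformClustering_of_transferGapThermal` — lattice-units socket (fixed `β`, all large tori);
* `hasLatticeMassGap_of_uniformTransferGapThermal` — **§5's `UniformTransferGapThermal r sch (Δ·a) X` ALONE gives
  `HasLatticeMassGap r sch Δ`**: the census items «cold range» (§6: `TransferGapThermal` is `ColdTraceBound` restricted to `T ≥ S+1`,
  «not known to suffice») and «volume floor» are discharged — no cold range, no volume floor, no rate loss;
* `hasLatticeMassGap_of_uniformTransferGap_halfHeight` — §8c sharpened: JW's uniform gap `UniformTransferGap r sch m`, `m_k ≥ Δ a_k`,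
  plus a uniform thermal multiplicity bound at HALF height (`UniformThermalMultiplicity r sch (fun S => S − 1) X₀`, i.e. `x(S+1) ≤ X₀`)
  gives the clause at `Δ` (the tree's `uniformColdTraceBound_of_uniformTransferGap` needs aspect `≤ 1/(2j)` and loses the factor `1 − 1/j`).

Mechanism: the thermal double sum of the trace formula is bounded at TOTAL time (`SpectralSeam.abs_trace_pow_mul_pow_mul_le`), so no trace
excess below `S + 1` is ever consumed.  [folklore: Osterwalder–Seiler 1978 §3; Montvay–Münster (1.195); Jaffe–Witten 2000 §5]

HONEST FRAMING: format theorems between hypothesis schemas («what a volume-uniform transfer-gap theorem would have to say»); they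
prove no gap.  The line's LOAD and thermal face stay open, as do `BalabanLadder.IR`, a lattice gap, and the Yang–Mills mass gap (Clay);
R4 of the ladder closes only the conditional finite-𝕋⁴ rung `BalabanLadder.UV`.
-/

set_option autoImplicit false

noncomputable section

open scoped BigOperators
open Filter Topology MeasureTheory
open Literature.MathematicalPhysics.QuantumFieldTheory Literature.MathematicalPhysics.QuantumLattice
open Literature.MathematicalPhysics.QuantumFieldTheory.Balaban1983to89.Sufficient
  (TransferGapThermal UniformTransferGapThermal TransferGap UniformTransferGap ThermalMultiplicityBound
    UniformThermalMultiplicity eventually_le_L)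

namespace Summit.QuantumFields.YangMills.Cruxes.IR.VacuumEscape

variable {G : Type} [Group G] [TopologicalSpace G] [IsTopologicalGroup G] [CompactSpace G]
  [MeasurableSpace G] [BorelSpace G]

/-! ## §1 FI-T supplies the two inputs of the spectral seam -/

/-- **FI-T ⇒ (gap rate, half-height multiplicity).**  `TransferGapThermal ρ β S μ X` (`x(t+1) ≤ X e^{−μ(t−S)}`, `t ≥ S`) with
`X ≥ 0` gives a rate bound `x(m+2) ≤ K e^{−μ(m+2)}` for ALL `m` (finitely many short times absorbed into `K`) and `x(S+1) ≤ X`.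
[folklore] -/
theorem gap_purity_of_transferGapThermal {N : ℕ} {ρ : G →* Matrix (Fin N) (Fin N) ℂ} {β : ℝ} {S : ℕ} {μ X : ℝ}
    (hX : 0 ≤ X) (h : TransferGapThermal ρ β S μ X) :
    (∃ K : ℝ, ∀ m : ℕ, traceExcess ρ β (2 * S + 1) (m + 2) ≤ K * Real.exp (-(μ * ((m + 2 : ℕ) : ℝ)))) ∧
      traceExcess ρ β (2 * S + 1) (S + 1) ≤ X := by
  refine ⟨?_, ?_⟩
  · set K₂ : ℝ := ∑ m ∈ Finset.range S, |traceExcess ρ β (2 * S + 1) (m + 2)| * Real.exp (μ * ((m + 2 : ℕ) : ℝ))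
      with hK₂
    have hK₂0 : 0 ≤ K₂ := Finset.sum_nonneg fun m _ => by positivity
    have hK₁0 : 0 ≤ X * Real.exp (μ * ((S : ℝ) + 1)) := by positivity
    refine ⟨X * Real.exp (μ * ((S : ℝ) + 1)) + K₂, fun m => ?_⟩
    by_cases hm : S ≤ m + 1
    · -- long times: the FI-T bound
      have h1 := h (m + 1) hm
      have hcast : (((m + 1 : ℕ) : ℝ) - S) = ((m + 2 : ℕ) : ℝ) - ((S : ℝ) + 1) := by push_cast; ring
      rw [hcast] at h1
      calc traceExcess ρ β (2 * S + 1) (m + 2)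
          ≤ X * Real.exp (-(μ * (((m + 2 : ℕ) : ℝ) - ((S : ℝ) + 1)))) := h1
        _ = X * Real.exp (μ * ((S : ℝ) + 1)) * Real.exp (-(μ * ((m + 2 : ℕ) : ℝ))) := by
            rw [mul_assoc, ← Real.exp_add]; congr 1; congr 1; ring
        _ ≤ (X * Real.exp (μ * ((S : ℝ) + 1)) + K₂) * Real.exp (-(μ * ((m + 2 : ℕ) : ℝ))) :=
            mul_le_mul_of_nonneg_right (le_add_of_nonneg_right hK₂0) (Real.exp_nonneg _)
    · -- short times: absorbed into `K₂`
      have hmS : m ∈ Finset.range S := Finset.mem_range.2 (by omega)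
      have hterm : |traceExcess ρ β (2 * S + 1) (m + 2)| * Real.exp (μ * ((m + 2 : ℕ) : ℝ)) ≤ K₂ :=
        Finset.single_le_sum (f := fun m => |traceExcess ρ β (2 * S + 1) (m + 2)| * Real.exp (μ * ((m + 2 : ℕ) : ℝ)))
          (fun m _ => by positivity) hmS
      have hpos : 0 < Real.exp (μ * ((m + 2 : ℕ) : ℝ)) := Real.exp_pos _
      calc traceExcess ρ β (2 * S + 1) (m + 2)
          ≤ |traceExcess ρ β (2 * S + 1) (m + 2)| := le_abs_self _
        _ = |traceExcess ρ β (2 * S + 1) (m + 2)| * Real.exp (μ * ((m + 2 : ℕ) : ℝ)) *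
              Real.exp (-(μ * ((m + 2 : ℕ) : ℝ))) := by
            rw [mul_assoc, ← Real.exp_add, add_neg_cancel, Real.exp_zero, mul_one]
        _ ≤ K₂ * Real.exp (-(μ * ((m + 2 : ℕ) : ℝ))) := mul_le_mul_of_nonneg_right hterm (Real.exp_nonneg _)
        _ ≤ (X * Real.exp (μ * ((S : ℝ) + 1)) + K₂) * Real.exp (-(μ * ((m + 2 : ℕ) : ℝ))) :=
            mul_le_mul_of_nonneg_right (le_add_of_nonneg_left hK₁0) (Real.exp_nonneg _)
  · have h1 := h S le_rfl
    simpa using h1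

/-! ## §2 FI-T ⇒ clustering -/

/-- **FI-T on one torus forces clustering at the same rate, for all separations `n ≤ S`.**  For bounded gauge-invariant local
observables `A, B` there is a time-width `w` such that at every `β ≥ 0`, rate `μ ∈ [0,1]`, `X ≥ 0` and every `S`:
`TransferGapThermal r.ρ β S μ X → |⟨A; τ_n B⟩_{β,(2S+1)⁴}| ≤ C_A C_B e^{2w}(2 + 5X + X²) e^{−μ n}` (`n ≤ S`). [folklore] -/
theorem abs_latticeConnectedCorr_le_of_transferGapThermal (r : LatticeRep G) (A B : YMSpecies G) {CA CB : ℝ}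
    (hCA : ∀ U, |A.F U| ≤ CA) (hCB : ∀ U, |B.F U| ≤ CB) :
    ∃ w : ℕ, ∀ (β : ℝ), 0 ≤ β → ∀ (μ X : ℝ), 0 ≤ μ → μ ≤ 1 → 0 ≤ X → ∀ S : ℕ,
      TransferGapThermal r.ρ β S μ X → ∀ n : ℕ, n ≤ S →
        |latticeConnectedCorr r.ρ β (2 * S + 1) A.F B.F n| ≤
          CA * CB * Real.exp (2 * w) * (2 + 5 * X + X ^ 2) * Real.exp (-(μ * n)) := by
  obtain ⟨w, hw⟩ := abs_latticeConnectedCorr_le_of_gap_purity r A B hCA hCB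
  refine ⟨w, fun β hβ μ X hμ0 hμ1 hX S hT n hn => ?_⟩
  obtain ⟨⟨K, hK⟩, hpur⟩ := gap_purity_of_transferGapThermal hX hT
  exact hw β hβ μ K X hμ0 hμ1 hX S hK hpur n hn

/-- **Lattice-units socket.**  At a fixed `β ≥ 0`, FI-T with one rate `g > 0` and one constant `X` on all tori `S ≥ S₁` gives volume-uniform
exponential clustering of every pair of gauge-invariant local observables at rate `min g 1`. [folklore] -/
theorem uniformClustering_of_transferGapThermal (r : LatticeRep G) {β : ℝ} (hβ : 0 ≤ β) {g X : ℝ}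
    (hg : 0 < g) (hX : 0 ≤ X) {S₁ : ℕ} (h : ∀ S : ℕ, S₁ ≤ S → TransferGapThermal r.ρ β S g X) :
    ∃ m : ℝ, 0 < m ∧ ∃ S₂ : ℕ, ∀ A B : YMSpecies G, ∃ C : ℝ, ∀ S n : ℕ, S₂ ≤ S → n ≤ S →
      |latticeConnectedCorr r.ρ β (2 * S + 1) A.F B.F n| ≤ C * Real.exp (-(m * n)) := by
  refine ⟨min g 1, lt_min hg one_pos, S₁, fun A B => ?_⟩
  obtain ⟨CA, hCA⟩ := A.bounded
  obtain ⟨CB, hCB⟩ := B.bounded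
  obtain ⟨w, hw⟩ := abs_latticeConnectedCorr_le_of_transferGapThermal r A B hCA hCB
  refine ⟨CA * CB * Real.exp (2 * w) * (2 + 5 * X + X ^ 2), fun S n hS hn => ?_⟩
  exact hw β hβ (min g 1) X (lt_min hg one_pos).le (min_le_right _ _) hX S
    ((h S hS).mono hX (min_le_left _ _)) n hn

/-! ## §3 Along a scheme: §5's FI-T alone gives the lattice mass-gap clause -/

/-- **`UniformTransferGapThermal r sch (Δ·a) X ⇒ HasLatticeMassGap r sch Δ`** (`Δ > 0`, `X ≥ 0`, `β_k ≥ 0` eventually): the transfer gap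
with thermal control at the half height of the symmetric torus, uniformly in the volume along the scheme, IS the clause — no cold range,
no volume floor, no rate loss. [folklore] -/
theorem hasLatticeMassGap_of_uniformTransferGapThermal {ι : Type} (r : LatticeRep G) (sch : SpeciesScheme ι)
    (hβ : ∀ᶠ k in atTop, 0 ≤ sch.β k) {Δ X : ℝ} (hΔ : 0 < Δ) (hX : 0 ≤ X)
    (h : UniformTransferGapThermal r sch (fun k => Δ * sch.a k) X) : HasLatticeMassGap r sch Δ := by
  intro A B
  obtain ⟨CA, hCA⟩ := A.bounded
  obtain ⟨CB, hCB⟩ := B.bounded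
  obtain ⟨w, hw⟩ := abs_latticeConnectedCorr_le_of_transferGapThermal r A B hCA hCB
  refine ⟨CA * CB * Real.exp (2 * w) * (2 + 5 * X + X ^ 2), ?_⟩
  have ha1 : ∀ᶠ k in atTop, Δ * sch.a k ≤ 1 := by
    have h1 := sch.tendsto_a.const_mul Δ
    rw [mul_zero] at h1
    exact (h1.eventually (gt_mem_nhds one_pos)).mono fun k hk => hk.le
  filter_upwards [h, ha1, hβ] with k hk hak hβk S hS n hn
  have hμ0 : 0 ≤ Δ * sch.a k := mul_nonneg hΔ.le (sch.a_pos k).le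
  have htarget : Real.exp (-(Δ * (sch.a k * n))) = Real.exp (-(Δ * sch.a k * n)) := by rw [mul_assoc]
  rw [htarget]
  exact hw (sch.β k) hβk (Δ * sch.a k) X hμ0 hak hX S (hk S hS) n hn

/-! ## §4 JW's gap plus thermal multiplicity at HALF height (§8c sharpened) -/

/-- **JW-GAP (trace form) ⇒ the rate input:** `x(T+3) ≤ e^{−m} x(T+2)` for all `T` gives `x(t+2) ≤ x(2) e^{2m} · e^{−m(t+2)}`. [folklore] -/
theorem gapInput_of_transferGap {N : ℕ} {ρ : G →* Matrix (Fin N) (Fin N) ℂ} {β : ℝ} {S : ℕ} {m : ℝ}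
    (h : TransferGap ρ β S m) :
    ∀ t : ℕ, traceExcess ρ β (2 * S + 1) (t + 2) ≤
      traceExcess ρ β (2 * S + 1) 2 * Real.exp (2 * m) * Real.exp (-(m * ((t + 2 : ℕ) : ℝ))) := by
  intro t
  induction t with
  | zero =>
    simp only [Nat.zero_add, Nat.cast_ofNat]
    rw [mul_assoc, ← Real.exp_add, show 2 * m + -(m * 2) = 0 by ring, Real.exp_zero, mul_one]
  | succ t ih =>
    have h1 := h t
    have hcast : ((t + 1 + 2 : ℕ) : ℝ) = ((t + 2 : ℕ) : ℝ) + 1 := by push_cast; ring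
    calc traceExcess ρ β (2 * S + 1) (t + 1 + 2)
        = traceExcess ρ β (2 * S + 1) (t + 3) := rfl
      _ ≤ Real.exp (-m) * traceExcess ρ β (2 * S + 1) (t + 2) := h1
      _ ≤ Real.exp (-m) * (traceExcess ρ β (2 * S + 1) 2 * Real.exp (2 * m) * Real.exp (-(m * ((t + 2 : ℕ) : ℝ)))) :=
          mul_le_mul_of_nonneg_left ih (Real.exp_nonneg _)
      _ = traceExcess ρ β (2 * S + 1) 2 * Real.exp (2 * m) * Real.exp (-(m * ((t + 1 + 2 : ℕ) : ℝ))) := by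
          rw [hcast]
          have e : Real.exp (-(m * (((t + 2 : ℕ) : ℝ) + 1))) = Real.exp (-m) * Real.exp (-(m * ((t + 2 : ℕ) : ℝ))) := by
            rw [← Real.exp_add]; congr 1; ring
          rw [e]; ring

/-- **JW's uniform gap + uniform thermal multiplicity at half height ⇒ the clause** (§8c of `MassGapFunctionalInequalities` sharpened:
there, aspect `2j(T₀+2) ≤ S+1` and rate loss `1 − 1/j`; here `T₀ S + 2 = S + 1` and the full rate): `UniformTransferGap r sch m` with
`Δ a_k ≤ m_k` eventually and `UniformThermalMultiplicity r sch (fun S => S - 1) X₀` (`x_{β_k,2S+1}(S+1) ≤ X₀`, `S ≥ L_k ≥ 1`) give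
`HasLatticeMassGap r sch Δ` (`Δ > 0`, `X₀ ≥ 0`, `β_k ≥ 0` eventually). [folklore] -/
theorem hasLatticeMassGap_of_uniformTransferGap_halfHeight {ι : Type} (r : LatticeRep G) (sch : SpeciesScheme ι)
    (hβ : ∀ᶠ k in atTop, 0 ≤ sch.β k) {Δ X₀ : ℝ} {m : ℕ → ℝ} (hΔ : 0 < Δ) (hX₀ : 0 ≤ X₀)
    (hgap : UniformTransferGap r sch m) (hrate : ∀ᶠ k in atTop, Δ * sch.a k ≤ m k)
    (hent : UniformThermalMultiplicity r sch (fun S => S - 1) X₀) : HasLatticeMassGap r sch Δ := by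
  intro A B
  obtain ⟨CA, hCA⟩ := A.bounded
  obtain ⟨CB, hCB⟩ := B.bounded
  obtain ⟨w, hw⟩ := abs_latticeConnectedCorr_le_of_gap_purity r A B hCA hCB
  refine ⟨CA * CB * Real.exp (2 * w) * (2 + 5 * X₀ + X₀ ^ 2), ?_⟩
  have ha1 : ∀ᶠ k in atTop, Δ * sch.a k ≤ 1 := by
    have h1 := sch.tendsto_a.const_mul Δ
    rw [mul_zero] at h1
    exact (h1.eventually (gt_mem_nhds one_pos)).mono fun k hk => hk.le
  filter_upwards [hgap, hrate, hent, ha1, hβ, eventually_le_L sch 1] with k hk hrk hek hak hβk hL S hS n hn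
  have hμ0 : 0 ≤ Δ * sch.a k := mul_nonneg hΔ.le (sch.a_pos k).le
  have hS1 : 1 ≤ S := hL.trans hS
  -- the rate input at rate `Δ a_k ≤ m_k`
  have hin := gapInput_of_transferGap (hk S hS)
  have hK : ∀ t : ℕ, traceExcess r.ρ (sch.β k) (2 * S + 1) (t + 2) ≤
      max (traceExcess r.ρ (sch.β k) (2 * S + 1) 2 * Real.exp (2 * m k)) 0 *
        Real.exp (-(Δ * sch.a k * ((t + 2 : ℕ) : ℝ))) := by
    intro t
    refine (hin t).trans ?_
    have ht0 : (0 : ℝ) ≤ ((t + 2 : ℕ) : ℝ) := Nat.cast_nonneg _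
    calc traceExcess r.ρ (sch.β k) (2 * S + 1) 2 * Real.exp (2 * m k) * Real.exp (-(m k * ((t + 2 : ℕ) : ℝ)))
        ≤ max (traceExcess r.ρ (sch.β k) (2 * S + 1) 2 * Real.exp (2 * m k)) 0 *
            Real.exp (-(m k * ((t + 2 : ℕ) : ℝ))) :=
          mul_le_mul_of_nonneg_right (le_max_left _ _) (Real.exp_nonneg _)
      _ ≤ _ := by
          refine mul_le_mul_of_nonneg_left (Real.exp_le_exp.2 (neg_le_neg ?_)) (le_max_right _ _)
          exact mul_le_mul_of_nonneg_right hrk ht0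
  -- the half-height multiplicity
  have hpur : traceExcess r.ρ (sch.β k) (2 * S + 1) (S + 1) ≤ X₀ := by
    have h1 : ThermalMultiplicityBound r.ρ (sch.β k) S (S - 1) X₀ := hek S hS
    unfold ThermalMultiplicityBound at h1
    rw [traceExcess_eq_of_eq r.ρ (sch.β k) (2 * S + 1) (show S + 1 = S - 1 + 2 by omega)]
    exact h1
  have htarget : Real.exp (-(Δ * (sch.a k * n))) = Real.exp (-(Δ * sch.a k * n)) := by rw [mul_assoc]
  rw [htarget]
  exact hw (sch.β k) hβk (Δ * sch.a k) _ X₀ hμ0 hak hX₀ S hK hpur n hn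

end Summit.QuantumFields.YangMills.Cruxes.IR.VacuumEscape

end
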